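import Summits.QuantumFields.YangMills.Theorems.UnitScaleTiltProp8ChartDiffBall
import HarnessLib

/-!
# Route `UnitScaleTilt`, crux K1 «MinimiserStabilityRegPr» (stmt-QuantumFields-19200), leaf V2′ `stub_halvingStep` — pillar P3 `ChartPerLevel`:
# **THE hCq CONJUNCT OF `ChartRemainderAt` PROVED: THE k-UNIFORM QUADRATIC REMAINDER OF THE MULTI-LEVEL (0.4)-CONSTRAINT MAP IN THE CHART**
# ([Balaban1985Variational] (44) «|C_j(A)| ≤ C₂(…)²» for the family's averaging, by the Cauchy estimate on the weighted ball)

Cell `ym3-torus` ∕ fleet seat `ym-ust-19200-p2` g6 (v8 PEN).  With hCd and the k-uniform sup bound on the weighted ball of radius `R′`, `12800ℓ²LR′ ≤ 1`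
(`…DiffBall`: `differentiableOn_chartLog_weightedBall`, `norm_chartLog_le_weightedBall`, `B = 120ℓLR′`), the second-order Cauchy estimate along a complex line
(`B7TransferAnalyticMean.norm_sub_sub_fderiv_le_of_line`) applied to the constraint map read through the WEIGHTING ISOMORPHISM `Y ↦ (w 1 b·Y b)_b` (which turns the
weighted ball into a sup-norm ball) gives, for every `Y` of weighted size `≤ r`, `4r ≤ R′`, and every index `i`:
**`‖chartLog η D Y i − (fderiv ℂ (chartLog η D) 0) Y i‖ ≤ (960ℓL/R′)·r²`** (`norm_chartLog_sub_fderiv_le_weightedBall`) — the hCq letter of the P3 text with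
`R := R′/4`, `C₂ := 960ℓL/R′`, constants depending on `d` and `L` only.  Hence (**`chartRemainder_hCd_hCq`**) the first two conjuncts of
`Prop8Chart.ChartRemainderAt L R₀ M₀ C₂ R B₀` hold for EVERY `L`-member, every admissible family with `R′·M ≥ 2L`, with these constants; the third (hH, the
weighted right inverse of the TRUE linearisation) is the P2↔P3 bridge and is NOT claimed.  Sorry-free, definition-free.  NOT a claim about the mass gap.

References: T. Bałaban, CMP **102** (1985) 277–309 [Balaban1985Variational] ((44)–(48) p.285, (156)–(157) p.302); CMP **98** (1985) 17–51 [Balaban1985Averaging]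
(Props. 3–4 pp.36–38).
-/

noncomputable section

open scoped BigOperators Matrix.Norms.L2Operator
open NormedSpace Metric Set

namespace Summit.QuantumFields.YangMills.Theorems.Prop8Chart

open Literature.MathematicalPhysics.QuantumFieldTheory.Balaban1983to89
open T4Continuum BlockAveraging
open B6SectADomainsV1 (Domains)
open B6SectAOperatorsV1 (BondIdx)
open B5Eq118OneStroke (iterBlockOf)
open T3ContinuumYM3Torus (T3Family)
open Summit.QuantumFields.YangMills.Theorems.FlatCubeOpsText (Adm22 IsLevWeight)

/-- **THE hCq CONJUNCT: THE k-UNIFORM QUADRATIC REMAINDER ON THE WEIGHTED BALL.**  For a member `F`, heights `n, K`, a nested family `D` with `D.k = K − n` and the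
collar property, the level weights `w`, a radius `R′` with `12800·ℓ²·L·R′ ≤ 1`, and every `Y` with `w 1 b·‖Y b‖ ≤ r` for all `b`, `0 ≤ r`, `4r ≤ R′`:
`‖chartLog η D Y i − (fderiv ℂ (chartLog η D) 0) Y i‖ ≤ (960ℓL/R′)·r²` at every index `i` (`η = L^{−(K−n)}`).
[cite: Balaban1985Variational, (44) p.285, (47)-(48) p.285; Balaban1985Averaging, Prop. 3 (122)-(123) p.36] -/
theorem norm_chartLog_sub_fderiv_le_weightedBall (F : T3Family) (n K : ℕ) (D : Domains (F.P K)) (hDk : D.k = K - n)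
    (hcollar : ∀ (i : ℕ) (e : PBond (F.P K) (i + 1)), D.LamBond (i + 1) e → ∀ z : Site (F.P K) i, (blockOf z = e.src ∨ blockOf z = e.tgt) → z ∈ D.Om i)
    {w : ℕ → PBond (F.P K) 0 → ℝ} (hw : IsLevWeight F n K D w) {R' : ℝ} (hR' : 12800 * ((((F.P K).d + 2) * (F.P K).L : ℕ) : ℝ) ^ 2 * (F.L : ℝ) * R' ≤ 1)
    (hR'0 : 0 < R') (Y : PBond (F.P K) 0 → Matrix (Fin 2) (Fin 2) ℂ) {r : ℝ} (hr0 : 0 ≤ r) (hr : 4 * r ≤ R') (hY : ∀ b, w 1 b * ‖Y b‖ ≤ r)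
    (i : BondIdx D) :
    ‖chartLog (((F.L : ℝ)⁻¹) ^ (K - n)) D Y i -
        (fderiv ℂ (chartLog (((F.L : ℝ)⁻¹) ^ (K - n)) D :
          (PBond (F.P K) 0 → Matrix (Fin 2) (Fin 2) ℂ) → BondIdx D → Matrix (Fin 2) (Fin 2) ℂ) 0) Y i‖ ≤
      960 * ((((F.P K).d + 2) * (F.P K).L : ℕ) : ℝ) * (F.L : ℝ) / R' * r ^ 2 := by
  -- letters
  set η : ℝ := ((F.L : ℝ)⁻¹) ^ (K - n) with hη
  set ℓ : ℝ := ((((F.P K).d + 2) * (F.P K).L : ℕ) : ℝ) with hℓ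
  have hwpos : ∀ b, 0 < w 1 b := fun b => by
    rw [hw 1 b, pow_one]
    have hL : (0 : ℝ) < F.L := by exact_mod_cast (F.P K).L_pos
    positivity
  -- the weighting isomorphism `T Z = (w⁻¹·Z)`, a continuous linear map, and its inverse on `Y`
  set T : (PBond (F.P K) 0 → Matrix (Fin 2) (Fin 2) ℂ) →L[ℂ] (PBond (F.P K) 0 → Matrix (Fin 2) (Fin 2) ℂ) := ContinuousLinearMap.pi fun b => ((w 1 b : ℂ)⁻¹) • ContinuousLinearMap.proj (R := ℂ) (φ := fun _ => Matrix (Fin 2) (Fin 2) ℂ) b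
    with hT
  have hT_apply : ∀ (Z : PBond (F.P K) 0 → Matrix (Fin 2) (Fin 2) ℂ) (b : PBond (F.P K) 0), T Z b = ((w 1 b : ℂ)⁻¹) • Z b := fun Z b => rfl
  set Z : (PBond (F.P K) 0 → Matrix (Fin 2) (Fin 2) ℂ) := fun b => (w 1 b : ℂ) • Y b with hZ
  have hTZ : T Z = Y := by
    funext b
    rw [hT_apply, hZ]
    simp only [smul_smul]
    rw [inv_mul_cancel₀ (by exact_mod_cast (hwpos b).ne'), one_smul]
  have hZnorm : ‖Z‖ ≤ r := by
    refine (pi_norm_le_iff_of_nonneg hr0).2 fun b => ?_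
    rw [hZ]; simp only [norm_smul, Complex.norm_real, Real.norm_eq_abs, abs_of_pos (hwpos b)]
    exact hY b
  -- the component map through the weighting
  set g : (PBond (F.P K) 0 → Matrix (Fin 2) (Fin 2) ℂ) → Matrix (Fin 2) (Fin 2) ℂ := fun A => chartLog η D A i with hg
  set Φ : (PBond (F.P K) 0 → Matrix (Fin 2) (Fin 2) ℂ) → Matrix (Fin 2) (Fin 2) ℂ := fun X => g (T X) with hΦ
  -- `T` maps the sup ball of radius `R′` into the weighted ball
  have hmaps : ∀ X : PBond (F.P K) 0 → Matrix (Fin 2) (Fin 2) ℂ, X ∈ ball (0 : PBond (F.P K) 0 → Matrix (Fin 2) (Fin 2) ℂ) R' → ∀ b, w 1 b * ‖T X b‖ < R' := by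
    intro X hX b
    rw [mem_ball_zero_iff] at hX
    rw [hT_apply, norm_smul, norm_inv, Complex.norm_real, Real.norm_eq_abs, abs_of_pos (hwpos b), ← mul_assoc,
      mul_inv_cancel₀ (hwpos b).ne', one_mul]
    exact (norm_le_pi_norm X b).trans_lt hX
  -- differentiability and the bound on the ball
  have hdiffOn := differentiableOn_chartLog_weightedBall F n K D hDk hcollar hw hR'
  have hΦd : DifferentiableOn ℂ Φ (ball (0 : PBond (F.P K) 0 → Matrix (Fin 2) (Fin 2) ℂ) R') := by
    intro X hX
    have hgX : DifferentiableAt ℂ g (T X) := by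
      have h := hdiffOn (T X) (hmaps X hX)
      have hopen : IsOpen {Y : PBond (F.P K) 0 → Matrix (Fin 2) (Fin 2) ℂ | ∀ b, w 1 b * ‖Y b‖ < R'} := by
        have : {Y : PBond (F.P K) 0 → Matrix (Fin 2) (Fin 2) ℂ | ∀ b, w 1 b * ‖Y b‖ < R'} = ⋂ b, {Y : PBond (F.P K) 0 → Matrix (Fin 2) (Fin 2) ℂ | w 1 b * ‖Y b‖ < R'} := by ext Y; simp
        rw [this]
        exact isOpen_iInter_of_finite fun b => isOpen_lt (continuous_const.mul (continuous_apply b).norm) continuous_const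
      have hd := (h.differentiableAt (hopen.mem_nhds (hmaps X hX)))
      exact (differentiableAt_pi.mp hd) i
    exact (hgX.comp X T.differentiableAt).differentiableWithinAt
  have hΦB : ∀ X ∈ ball (0 : PBond (F.P K) 0 → Matrix (Fin 2) (Fin 2) ℂ) R', ‖Φ X‖ ≤ 120 * ℓ * (F.L : ℝ) * R' := fun X hX =>
    norm_chartLog_le_weightedBall F n K D hDk hcollar hw hR' (hmaps X hX) i
  -- the Cauchy estimate along the line `t ↦ t•Z`
  have h0 : (0 : PBond (F.P K) 0 → Matrix (Fin 2) (Fin 2) ℂ) ∈ ball (0 : PBond (F.P K) 0 → Matrix (Fin 2) (Fin 2) ℂ) R' := mem_ball_self hR'0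
  have hv : 4 * ‖Z‖ ≤ R' - ‖(0 : PBond (F.P K) 0 → Matrix (Fin 2) (Fin 2) ℂ) - 0‖ := by rw [sub_zero, norm_zero, sub_zero]; linarith
  have hC := B7TransferAnalyticMean.norm_sub_sub_fderiv_le_of_line hΦd hΦB h0 hv
  rw [zero_add, sub_self, norm_zero, sub_zero] at hC
  -- identify the three terms
  have hΦZ : Φ Z = chartLog η D Y i := by rw [hΦ]; simp only [hg]; rw [hTZ]
  have hΦ0 : Φ 0 = 0 := by rw [hΦ]; simp only [hg, map_zero, chartLog_zero, Pi.zero_apply]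
  have hdiff0 := differentiableAt_chartLog_zero (P := F.P K) (𝔸 := Matrix (Fin 2) (Fin 2) ℂ) η D
  have hg0 : DifferentiableAt ℂ g 0 := (differentiableAt_pi.mp hdiff0) i
  have hfd : fderiv ℂ Φ 0 Z = (fderiv ℂ (chartLog η D : (PBond (F.P K) 0 → Matrix (Fin 2) (Fin 2) ℂ) → BondIdx D → Matrix (Fin 2) (Fin 2) ℂ) 0) Y i := by
    have h1 : fderiv ℂ Φ 0 = (fderiv ℂ g (T 0)).comp T := by
      rw [hΦ]
      exact fderiv_comp 0 (by rw [map_zero]; exact hg0) T.differentiableAt |>.trans (by rw [T.fderiv])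
    rw [h1, ContinuousLinearMap.comp_apply, map_zero, hTZ]
    have h2 : fderiv ℂ g 0 = (ContinuousLinearMap.proj (R := ℂ) (φ := fun _ : BondIdx D => Matrix (Fin 2) (Fin 2) ℂ) i).comp
        (fderiv ℂ (chartLog η D : (PBond (F.P K) 0 → Matrix (Fin 2) (Fin 2) ℂ) → BondIdx D → Matrix (Fin 2) (Fin 2) ℂ) 0) :=
      ((hasFDerivAt_pi'.mp hdiff0.hasFDerivAt) i).fderiv
    rw [h2, ContinuousLinearMap.comp_apply, ContinuousLinearMap.proj_apply]
  rw [hΦZ, hΦ0, sub_zero, hfd] at hC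
  refine hC.trans ?_
  -- `8·(120ℓLR′)·‖Z‖²/R′² ≤ (960ℓL/R′)·r²`
  have hZ2 : ‖Z‖ ^ 2 ≤ r ^ 2 := pow_le_pow_left₀ (norm_nonneg _) hZnorm 2
  have hℓ0 : 0 ≤ ℓ := Nat.cast_nonneg _
  have hL0 : (0 : ℝ) ≤ F.L := Nat.cast_nonneg _
  have heq : 8 * (120 * ℓ * (F.L : ℝ) * R') * ‖Z‖ ^ 2 / R' ^ 2 = 960 * ℓ * (F.L : ℝ) / R' * ‖Z‖ ^ 2 := by
    rw [div_eq_iff (pow_ne_zero 2 hR'0.ne'), div_mul_eq_mul_div, div_mul_eq_mul_div, eq_div_iff hR'0.ne']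
    ring
  rw [heq]
  gcongr

/-- **hCd ∧ hCq OF THE P3 TEXT, ASSEMBLED** with constants depending on `d` and `L` only: for every member `F` with `F.L = L`, all heights `n < K`, every `R′ ≥ 2L`, `M ≥ 1`,
every nested family `D` with `D.k = K − n` admissible `Adm22 D R′ M`, and the F4 pen's weights `w`: with `R⋆ := 1/(12800ℓ²L)` (`ℓ = (d+2)L`), `R := R⋆/4`,
`C₂ := 960ℓL/R⋆`, the map `chartLog η D` is ℂ-differentiable on the weighted ball of radius `R` and satisfies the quadratic remainder letter there — the first
two conjuncts of `Prop8Chart.ChartRemainderAt L (2L) 1 C₂ R B₀` for any `B₀` (the third, hH, is not claimed). [cite: Balaban1985Variational, (44)-(48) p.285] -/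
theorem chartRemainder_hCd_hCq (F : T3Family) (n K : ℕ) {R' M : ℕ} (hR'L : 2 * (F.P K).L ≤ R') (hM : 1 ≤ M) (D : Domains (F.P K))
    (hDk : D.k = K - n) (hAdm : Adm22 D R' M) {w : ℕ → PBond (F.P K) 0 → ℝ} (hw : IsLevWeight F n K D w) :
    let Rs : ℝ := (12800 * ((((F.P K).d + 2) * (F.P K).L : ℕ) : ℝ) ^ 2 * (F.L : ℝ))⁻¹
    DifferentiableOn ℂ
        (chartLog (((F.L : ℝ)⁻¹) ^ (K - n)) D :
          (PBond (F.P K) 0 → Matrix (Fin 2) (Fin 2) ℂ) → BondIdx D → Matrix (Fin 2) (Fin 2) ℂ)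
        {Y | ∀ b, w 1 b * ‖Y b‖ < Rs / 4} ∧
      ∀ (Y : PBond (F.P K) 0 → Matrix (Fin 2) (Fin 2) ℂ) (r : ℝ), r < Rs / 4 → (∀ b, w 1 b * ‖Y b‖ ≤ r) →
        ∀ i : BondIdx D,
          ‖chartLog (((F.L : ℝ)⁻¹) ^ (K - n)) D Y i -
              (fderiv ℂ (chartLog (((F.L : ℝ)⁻¹) ^ (K - n)) D :
                (PBond (F.P K) 0 → Matrix (Fin 2) (Fin 2) ℂ) → BondIdx D → Matrix (Fin 2) (Fin 2) ℂ) 0) Y i‖ ≤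
            (960 * ((((F.P K).d + 2) * (F.P K).L : ℕ) : ℝ) * (F.L : ℝ) / Rs) * r ^ 2 := by
  intro Rs
  have hL1 : (1 : ℝ) ≤ F.L := by exact_mod_cast (F.P K).L_pos
  have hℓ1 : (1 : ℝ) ≤ ((((F.P K).d + 2) * (F.P K).L : ℕ) : ℝ) := by
    exact_mod_cast Nat.one_le_iff_ne_zero.mpr (Nat.mul_ne_zero (by omega) (by have := (F.P K).hL.2; omega))
  have hden : 0 < 12800 * ((((F.P K).d + 2) * (F.P K).L : ℕ) : ℝ) ^ 2 * (F.L : ℝ) := by positivity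
  have hRs0 : 0 < Rs := inv_pos.mpr hden
  have hRs : 12800 * ((((F.P K).d + 2) * (F.P K).L : ℕ) : ℝ) ^ 2 * (F.L : ℝ) * Rs ≤ 1 := by
    show 12800 * ((((F.P K).d + 2) * (F.P K).L : ℕ) : ℝ) ^ 2 * (F.L : ℝ) * (12800 * ((((F.P K).d + 2) * (F.P K).L : ℕ) : ℝ) ^ 2 * (F.L : ℝ))⁻¹ ≤ 1
    rw [mul_inv_cancel₀ hden.ne']
  have hRs4 : 12800 * ((((F.P K).d + 2) * (F.P K).L : ℕ) : ℝ) ^ 2 * (F.L : ℝ) * (Rs / 4) ≤ 1 := by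
    have : Rs / 4 ≤ Rs := by linarith
    exact le_trans (mul_le_mul_of_nonneg_left this hden.le) hRs
  have hRM : 2 * (F.P K).L ≤ R' * M + 1 := by
    have : R' ≤ R' * M := Nat.le_mul_of_pos_right R' hM
    omega
  have hcollar := collar_of_adm22 D hAdm hRM
  refine ⟨differentiableOn_chartLog_weightedBall F n K D hDk hcollar hw hRs4, fun Y r hr hY i => ?_⟩
  rcases lt_or_ge r 0 with hneg | hr0
  · -- no such `Y` unless the lattice has no bonds; then both sides are harmless: the hypothesis at any bond is contradictory
    exfalso
    have h := hY ⟨fun _ => 0, i.1.2.dir⟩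
    have hw0 : 0 ≤ w 1 ⟨fun _ => 0, i.1.2.dir⟩ * ‖Y ⟨fun _ => 0, i.1.2.dir⟩‖ := by
      rw [hw 1, pow_one]
      have hL : (0 : ℝ) < F.L := by linarith
      exact mul_nonneg (by positivity) (norm_nonneg _)
    linarith
  exact norm_chartLog_sub_fderiv_le_weightedBall F n K D hDk hcollar hw hRs hRs0 Y hr0 (by linarith) hY i

end Summit.QuantumFields.YangMills.Theorems.Prop8Chart

end
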